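import Summits.QuantumFields.BalabanUV.T4Continuum.Support.LateMergers

/-!
# Balaban T⁴ spine, estimate NE7b (node U5c, COUNT member P1): LATE MERGERS WITH AN OVERDUE PARTNER under [CONV-D]
# — part 2 of 4: placement and support of the booked cost, the span inequality, the merger arithmetic, sanity

Cell `pub-balaban`, lineage `b2b-balaban-t4-ne7b-p1` (generation 17), self-row `T4-U5c.E-NE7b-LATEMERGE-K*`, residual
(H1) of GAPS G-ne7bp1g16-1; Summits-side NEW WORK under the LEAN PLACEMENT RULE 2026-08-19 (cell bookkeeping, print
quoted for CONTEXT only); same namespace as part 1 (`…Support.LateMergers`), which it imports and ONLY it.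

HONEST FRAMING.  Rung (B)+1 of the FINITE-VOLUME T⁴ continuum programme: bookkeeping over the lineage's OWN typed
ledger of persistent large-field histories (`T4PersistenceDictionary.Gen`, `T4TaggedShapeBanking`, `T4CountHorizon`).
NOT infinite volume, NOT a mass gap, NOT the Clay problem, NOT a proof of NE7b; nothing of Bałaban's expansion is
asserted; `BetaPertH` / (B) / (B^μ) are not involved (upstream of the term families, displayed by name elsewhere).
HONEST DEPENDENCY (cell, verbatim): continuum YM on T⁴ ⇐ BetaPertH ∧ nine spine estimates (0/9 proved); BetaPertH ⇐
(D1) ∧ (D4) ∧ CAP+tail; G-an2-4 gates asym, D1 and NE2/3/4.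

CONTENT (part 2; every declaration [folklore], sorry-free, standard axioms).  §3 For `ConsistentTH sh C K R D G`: every
event's TRUE window sits in `[rootStep, reach]` (`rootStep_le_place`, `place_add_le_reach`), every size epoch in
`[rootStep, reach + D)` (`event_window` — a late merger's connector epoch may run up to `D` steps past the partners'
reaches), hence the booked cost `costT` vanishes off `[rootStep, reach + D)` ⊆ the PADDED life (`cost_eq_zero`,
`cost_eq_zero_of_not_mem_life`).  §4 THE SPAN INEQUALITY WITH HORIZON AND LATE MERGERS `ConsistentTH.spanAges`: for a
consistent, fresh genealogy `min reach (K − D + 1) − rootStep + partnerAges ≤ Σ_{events} bankW` (the `+D` banked by a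
merger-shaped label pays the age of a partner joined after the horizon; pure-ℕ step `merge_span_arith`), and its
pending form `horizonSpan_add_partnerAges_le` (`K − D < reach`).  §5 `mergeH_arith`: the ℝ-arithmetic of the merger pay
at the absorbed-root index with the horizon in the bank (consumed by part 3).  §6 SANITY (non-vacuity, decided on the
cross-read table `XreadC4.C₀`, `R ≡ 2`, `K = 10`, `D = 3`): the late merger `Zl` of an OVERDUE thin region (true reach
`8 = K − D + 1`) with a region born at step `9` IS `ConsistentTH` and `FreshT`, hence `WF` over `padW`, is pending at the
horizon, and is NEITHER `ConsistentT` NOR `WF` for the true table — an admissible witness of the new labelling binder the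
frozen binder could not name; its horizon span + partner ages `5 ≤ 14` = its merger-padded banks; `lateMergers_zero`:
at `D = 0` the new data ARE the old (`ConsistentTH ↔ ConsistentT`, `padW W 0 = W`, `bankW … 0 = dictWT`,
`FreshT ↔ WF` given `ConsistentT`).

ABSOLUTE RULE.  No internally-minted statement enters as a cited fact: 0 `[cite:]` tags, every hypothesis of every
theorem is a displayed binder; the manuscripts under audit (B15 = [Balaban1989LargeFieldI], B16 =
[Balaban1989LargeFieldII]; (1.79)–(1.89) pp. 383–387, (2.5)/(2.7)/(2.9) p. 361 of B14 = [Balaban1988RenormLattice])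
appear in docstrings as CONTEXT only, never as facts; programme-internal claims are not cited.  NOT PRINTED: [CONV-D],
the ledger, the banks and every inequality here are the cell's MODEL of print's procedure, handed to the (ID) owner
(GAPS G-ne7bp1g9-1) as the target of an identification nobody in the cell asserts.
-/

namespace Summit.QuantumFields.BalabanUV.T4Continuum.LateMergers

open Finset
open Literature.MathematicalPhysics.QuantumFieldTheory.Balaban1983to89
open T4PersistenceDictionary T4PersistentHistoryCount T4BankedInduction T4PrintedShapeBanking
open T4WeightBudget T4GlobalDenominator T4LiveClassFibration T4LiveStructureGas T4LiveGasToTerms T4RecordPriceSeam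
open T4PartnerMultiplicity T4BranchingRecordsGas T4TaggedShapeBanking T4CanonicalMenus T4CountHorizon

noncomputable section

/-! ## §3 Placement and support of the booked cost: true windows, padded lives -/

section Support

variable {ε : Type*} [DecidableEq ε] {sh : ε → PEv} {C : T4PrintedShapeBanking.Consts} {K : ℕ} {R : ℕ → ℕ} {D : ℕ}

/-- every event's (true) window opens no earlier than the root birth. [folklore] -/
theorem ConsistentTH.rootStep_le_place :
    ∀ {G : Gen ε}, ConsistentTH sh C K R D G → ∀ e ∈ G.events, G.rootStep ≤ G.place (dictWT sh R C.n₁) e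
  | Gen.born b j, _, e, _ => le_rfl
  | Gen.renew G e h, hc, e', he' => by
      simp only [ConsistentTH] at hc
      obtain ⟨hG, -, -, hr, -⟩ := hc
      have hroot := ConsistentTH.rootStep_le_reach hG
      rw [Gen.rootStep_renew, Gen.place_renew]
      split_ifs with h1
      · omega
      · rw [Gen.events_renew, Finset.mem_insert] at he'
        exact ConsistentTH.rootStep_le_place hG e' (he'.resolve_left h1)
  | Gen.merge X Y e, hc, e', he' => by
      simp only [ConsistentTH] at hc
      obtain ⟨hX, hY, -, -, -, -, -, -⟩ := hc
      rw [Gen.rootStep_merge, Gen.place_merge]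
      split_ifs with h1 h2
      · have := ConsistentTH.rootStep_le_reach hX
        have := le_max_left (X.reach (dictWT sh R C.n₁)) (Y.reach (dictWT sh R C.n₁))
        omega
      · exact (min_le_left _ _).trans (ConsistentTH.rootStep_le_place hX e' h2)
      · rw [Gen.events_merge, Finset.mem_insert, Finset.mem_union] at he'
        have he'Y : e' ∈ Y.events := by tauto
        exact (min_le_right _ _).trans (ConsistentTH.rootStep_le_place hY e' he'Y)

/-- every event's (true) window closes no later than the (true) reach. [folklore] -/
theorem ConsistentTH.place_add_le_reach :
    ∀ {G : Gen ε}, ConsistentTH sh C K R D G → ∀ e ∈ G.events,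
      G.place (dictWT sh R C.n₁) e + dictWT sh R C.n₁ e ≤ G.reach (dictWT sh R C.n₁)
  | Gen.born b j, _, e, he => by
      simp only [Gen.events_born, Finset.mem_singleton] at he
      subst he
      simp
  | Gen.renew G e h, hc, e', he' => by
      simp only [ConsistentTH] at hc
      obtain ⟨hG, -, -, hr, -⟩ := hc
      rw [Gen.reach_renew, Gen.place_renew]
      split_ifs with h1
      · subst h1
        exact le_rfl
      · rw [Gen.events_renew, Finset.mem_insert] at he'
        have := ConsistentTH.place_add_le_reach hG e' (he'.resolve_left h1)
        omega
  | Gen.merge X Y e, hc, e', he' => by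
      simp only [ConsistentTH] at hc
      obtain ⟨hX, hY, -⟩ := hc
      rw [Gen.reach_merge, Gen.place_merge]
      split_ifs with h1 h2
      · subst h1
        exact le_rfl
      · have := ConsistentTH.place_add_le_reach hX e' h2
        have := le_max_left (X.reach (dictWT sh R C.n₁)) (Y.reach (dictWT sh R C.n₁))
        omega
      · rw [Gen.events_merge, Finset.mem_insert, Finset.mem_union] at he'
        have he'Y : e' ∈ Y.events := by tauto
        have := ConsistentTH.place_add_le_reach hY e' he'Y
        have := le_max_right (X.reach (dictWT sh R C.n₁)) (Y.reach (dictWT sh R C.n₁))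
        omega

/-- every event's size epoch opens no earlier than the root birth and closes before the (true) reach PLUS `D` (a late
merger's connector epoch may run up to `D` steps past the partners' reaches). [folklore] -/
theorem ConsistentTH.event_window (hdC : fatWait C.dC ≤ C.n₁) :
    ∀ {G : Gen ε}, ConsistentTH sh C K R D G → ∀ e ∈ G.events,
      G.rootStep ≤ (sh e).step ∧ (sh e).step + fw C (sh e) < G.reach (dictWT sh R C.n₁) + D
  | Gen.born b j, hc, e, he => by
      simp only [ConsistentTH] at hc
      obtain ⟨hk, hs, -⟩ := hc
      simp only [Gen.events_born, Finset.mem_singleton] at he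
      subst he
      simp only [Gen.rootStep_born, Gen.reach_born]
      rw [dictWT_kind0 hk, fw_kind0 hk]
      omega
  | Gen.renew G e h, hc, e', he' => by
      simp only [ConsistentTH] at hc
      obtain ⟨hG, hk, hs, hr, -⟩ := hc
      simp only [Gen.events_renew, Finset.mem_insert] at he'
      simp only [Gen.rootStep_renew, Gen.reach_renew]
      have hroot := ConsistentTH.rootStep_le_reach hG
      rcases he' with rfl | he'
      · rw [fw_kind1 hk, dictWT_kind1 hk]
        omega
      · have := ConsistentTH.event_window hdC hG e' he'
        omega
  | Gen.merge X Y e, hc, e', he' => by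
      simp only [ConsistentTH] at hc
      obtain ⟨hX, hY, hk, hx, hx', hy, hy', htK⟩ := hc
      simp only [Gen.events_merge, Finset.mem_insert, Finset.mem_union] at he'
      simp only [Gen.rootStep_merge, Gen.reach_merge]
      have hrX := ConsistentTH.rootStep_le_reach hX
      rcases he' with rfl | he' | he'
      · rw [fw_kind2 hk, dictWT_kind2 hk]
        omega
      · have := ConsistentTH.event_window hdC hX e' he'
        omega
      · have := ConsistentTH.event_window hdC hY e' he'
        omega

/-- the booked cost lives on `[rootStep, reach + D)`. [folklore] -/
theorem ConsistentTH.cost_eq_zero (hdC : fatWait C.dC ≤ C.n₁) {G : Gen ε} (hc : ConsistentTH sh C K R D G) {n : ℕ}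
    (hn : n < G.rootStep ∨ G.reach (dictWT sh R C.n₁) + D ≤ n) : costT sh C K R G n = 0 := by
  unfold costT
  refine Finset.sum_eq_zero fun e he => ?_
  have h1 := ConsistentTH.rootStep_le_place hc e he
  have h2 := ConsistentTH.place_add_le_reach hc e he
  have h3 := ConsistentTH.event_window hdC hc e he
  have hw : n ∉ Finset.Ico (G.place (dictWT sh R C.n₁) e) (G.place (dictWT sh R C.n₁) e + dictWT sh R C.n₁ e) := by
    rw [Finset.mem_Ico]
    omega
  have hs : n ∉ supp C (sh e) := by
    simp only [supp, Finset.mem_Ioc]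
    omega
  rw [wfloor_of_not_mem hw, sz_eq_zero_of_not_mem hs, add_zero]

/-- … hence outside the PADDED life. [folklore] -/
theorem ConsistentTH.cost_eq_zero_of_not_mem_life (hdC : fatWait C.dC ≤ C.n₁) {G : Gen ε}
    (hc : ConsistentTH sh C K R D G) {n : ℕ} (hn : n ∉ life (padW (dictWT sh R C.n₁) D) G) :
    costT sh C K R G n = 0 := by
  rw [mem_life, not_and_or, not_le, not_lt] at hn
  have hp := reach_add_le_reach_padW (dictWT sh R C.n₁) D G
  exact ConsistentTH.cost_eq_zero hdC hc (by omega)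

/-! ## §4 Span versus banks: the horizon span and ALL partner ages are covered by the merger-padded banks -/

/-- ℕ: the merge step of `ConsistentTH.spanAges` (pure arithmetic; `H = K − D`, `We` the merger's window, `SX`, `SY`
the partners' bank sums). [folklore] -/
theorem merge_span_arith {Xr Yr rx ry t H We D SX SY paX paY : ℕ}
    (hx : rx ≤ t) (hy : ry ≤ t) (ht : t ≤ H + D) (hx' : t < Xr ∨ H < Xr) (hy' : t < Yr ∨ H < Yr)
    (hrX : rx ≤ Xr) (hrY : ry ≤ Yr)
    (ihX : min Xr (H + 1) - rx + paX ≤ SX) (ihY : min Yr (H + 1) - ry + paY ≤ SY) :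
    min (max Xr Yr + We) (H + 1) - min rx ry + (paX + paY + (t + 1 - max rx ry)) ≤ We + D + (SX + SY) := by
  by_cases htH : t ≤ H
  · have hXt : t < Xr := by omega
    have hYt : t < Yr := by omega
    rcases le_total Xr Yr with hXY | hXY
    · rw [max_eq_right hXY]
      rcases le_total rx ry with hr | hr
      · rw [min_eq_left hr, max_eq_right hr]; omega
      · rw [min_eq_right hr, max_eq_left hr]; omega
    · rw [max_eq_left hXY]
      rcases le_total rx ry with hr | hr
      · rw [min_eq_left hr, max_eq_right hr]; omega
      · rw [min_eq_right hr, max_eq_left hr]; omega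
  · have hXH : H < Xr := by omega
    have hYH : H < Yr := by omega
    rw [min_eq_right (by omega : H + 1 ≤ max Xr Yr + We)]
    rw [min_eq_right (by omega : H + 1 ≤ Xr)] at ihX
    rw [min_eq_right (by omega : H + 1 ≤ Yr)] at ihY
    rcases le_total rx ry with hr | hr
    · rw [min_eq_left hr, max_eq_right hr]; omega
    · rw [min_eq_right hr, max_eq_left hr]; omega

/-- **THE SPAN INEQUALITY WITH HORIZON AND LATE MERGERS**: for a consistent, fresh genealogy, the HORIZON span
`min reach (K − D + 1) − rootStep` plus ALL partner ages is at most the sum of the merger-padded banks of its events.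
(The `+D` banked by a merger-shaped label pays the age of a partner joined after the horizon; everything else
telescopes as in `T4PartnerMultiplicity.span_add_windowSurplus_le`.) [folklore] -/
theorem ConsistentTH.spanAges :
    ∀ {G : Gen ε}, ConsistentTH sh C K R D G → FreshT G →
      (min (G.reach (dictWT sh R C.n₁)) (K - D + 1) - G.rootStep) + partnerAges (PEv.step ∘ sh) G ≤
        ∑ e ∈ G.events, bankW sh R C.n₁ D e
  | Gen.born b j, hc, _ => by
      simp only [ConsistentTH] at hc
      obtain ⟨hk, -, -⟩ := hc
      simp only [Gen.reach_born, Gen.rootStep_born, partnerAges_born, Gen.events_born, Finset.sum_singleton,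
        add_zero]
      rw [bankW_kind0 hk]
      omega
  | Gen.renew G e h, hc, hf => by
      simp only [ConsistentTH] at hc
      obtain ⟨hG, hk, -, hr, -⟩ := hc
      simp only [FreshT] at hf
      have ih := ConsistentTH.spanAges hG hf.1
      rw [Gen.events_renew, Finset.sum_insert hf.2, bankW_kind1 hk]
      simp only [Gen.reach_renew, Gen.rootStep_renew, partnerAges_renew]
      omega
  | Gen.merge X Y e, hc, hf => by
      simp only [ConsistentTH] at hc
      obtain ⟨hX, hY, hk, hx, hx', hy, hy', htK⟩ := hc
      simp only [FreshT] at hf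
      obtain ⟨hfX, hfY, heX, heY, hd⟩ := hf
      have ihX := ConsistentTH.spanAges hX hfX
      have ihY := ConsistentTH.spanAges hY hfY
      have hrX := ConsistentTH.rootStep_le_reach hX
      have hrY := ConsistentTH.rootStep_le_reach hY
      have hmem : e ∉ X.events ∪ Y.events := by simp [heX, heY]
      rw [Gen.events_merge, Finset.sum_insert hmem, Finset.sum_union hd, bankW_kind2 hk]
      simp only [Gen.reach_merge, Gen.rootStep_merge, partnerAges_merge, Function.comp_apply]
      have h := merge_span_arith (We := dictWT sh R C.n₁ e) (paX := partnerAges (PEv.step ∘ sh) X)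
        (paY := partnerAges (PEv.step ∘ sh) Y) hx hy (by omega : (sh e).step ≤ (K - D) + D) hx' hy' hrX hrY ihX ihY
      omega

/-- … in particular, PENDING AT THE HORIZON (`K − D < reach`): `(K − D + 1 − rootStep) + partnerAges ≤ Σ bankW`.
[folklore] -/
theorem ConsistentTH.horizonSpan_add_partnerAges_le {G : Gen ε} (hc : ConsistentTH sh C K R D G) (hf : FreshT G)
    (hK : K - D < G.reach (dictWT sh R C.n₁)) :
    (K - D + 1 - G.rootStep) + partnerAges (PEv.step ∘ sh) G ≤ ∑ e ∈ G.events, bankW sh R C.n₁ D e := by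
  have h := ConsistentTH.spanAges hc hf
  rwa [min_eq_right (by omega : K - D + 1 ≤ G.reach (dictWT sh R C.n₁))] at h

end Support

/-! ## §5 The merger arithmetic at the absorbed-root index, horizon in the bank (ℝ; consumed by part 3) -/

/-- ℝ: the merger arithmetic at the ABSORBED ROOT index with the horizon in the bank: for `1 ≤ P`, `0 ≤ Q ≤ Lr·P`,
`1 ≤ Lr`, nonnegative constants,
`(n₁ + Q)·E₂(LrP)^q + E₃(LrQ)^q·dC + (κ₁(n₁ + Q + Dr) + E₀) ≤ ((n₁ + Lr)E₂Lr^q + dC·E₃·Lr^q·Lr^q)·P^{q+1} +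
(κ₁(n₁ + Dr + Lr·P) + E₀)`. [folklore] -/
theorem mergeH_arith {P Q Lr n₁ dC Dr E₂ E₃ κ₁ E₀ : ℝ} (hP : 1 ≤ P) (hQ0 : 0 ≤ Q) (hQ : Q ≤ Lr * P) (hL : 1 ≤ Lr)
    (hE₂ : 0 ≤ E₂) (hE₃ : 0 ≤ E₃) (hn : 0 ≤ n₁) (hd : 0 ≤ dC) (hκ : 0 ≤ κ₁) (q : ℕ) :
    (n₁ + Q) * (E₂ * (Lr * P) ^ q) + E₃ * (Lr * Q) ^ q * dC + (κ₁ * (n₁ + Q + Dr) + E₀) ≤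
      ((n₁ + Lr) * E₂ * Lr ^ q + dC * E₃ * Lr ^ q * Lr ^ q) * P ^ (q + 1) + (κ₁ * (n₁ + Dr + Lr * P) + E₀) := by
  have hP0 : 0 ≤ P := zero_le_one.trans hP
  have hL0 : 0 ≤ Lr := zero_le_one.trans hL
  have hPq : P ^ q ≤ P ^ (q + 1) := pow_le_pow_right₀ hP (Nat.le_succ q)
  have h1 : n₁ + Q ≤ (n₁ + Lr) * P := by nlinarith
  have t1 : (n₁ + Q) * (E₂ * (Lr * P) ^ q) ≤ (n₁ + Lr) * E₂ * Lr ^ q * P ^ (q + 1) := by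
    rw [mul_pow]
    calc (n₁ + Q) * (E₂ * (Lr ^ q * P ^ q)) ≤ ((n₁ + Lr) * P) * (E₂ * (Lr ^ q * P ^ q)) :=
          mul_le_mul_of_nonneg_right h1 (by positivity)
      _ = (n₁ + Lr) * E₂ * Lr ^ q * (P ^ q * P) := by ring
      _ = (n₁ + Lr) * E₂ * Lr ^ q * P ^ (q + 1) := by rw [pow_succ]
  have hLQ : (Lr * Q) ^ q ≤ (Lr * (Lr * P)) ^ q :=
    pow_le_pow_left₀ (mul_nonneg hL0 hQ0) (mul_le_mul_of_nonneg_left hQ hL0) q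
  have t2 : E₃ * (Lr * Q) ^ q * dC ≤ dC * E₃ * Lr ^ q * Lr ^ q * P ^ (q + 1) := by
    calc E₃ * (Lr * Q) ^ q * dC ≤ E₃ * (Lr * (Lr * P)) ^ q * dC :=
          mul_le_mul_of_nonneg_right (mul_le_mul_of_nonneg_left hLQ hE₃) hd
      _ = dC * E₃ * Lr ^ q * Lr ^ q * P ^ q := by rw [mul_pow, mul_pow]; ring
      _ ≤ dC * E₃ * Lr ^ q * Lr ^ q * P ^ (q + 1) := mul_le_mul_of_nonneg_left hPq (by positivity)
  have t3 : κ₁ * (n₁ + Q + Dr) ≤ κ₁ * (n₁ + Dr + Lr * P) := mul_le_mul_of_nonneg_left (by linarith) hκ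
  have e : ((n₁ + Lr) * E₂ * Lr ^ q + dC * E₃ * Lr ^ q * Lr ^ q) * P ^ (q + 1) =
      (n₁ + Lr) * E₂ * Lr ^ q * P ^ (q + 1) + dC * E₃ * Lr ^ q * Lr ^ q * P ^ (q + 1) := by ring
  rw [e]
  linarith

/-! ## §6 Sanity (non-vacuity): a late merger with an overdue partner is `ConsistentTH` and padded-well-formed, and is
neither `ConsistentT` nor well formed for the true table; `D = 0` is the old predicate -/

section Sanity

namespace Sanity

open T4PrintedShapeBanking.XreadC4

/-- an OVERDUE partner on the cross-read's table `R ≡ 2`, `C₀` (`n₁ = 1`): a thin region born at step `4`, window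
`fatWait 0 + 2 + 1 = 4`, true reach `8 = K − D + 1` at `K = 10`, `D = 3` — never healed under [CONV-D] [folklore] -/
def Xo : Gen PEv := Gen.born ((4, 0, 0) : PEv) 4
/-- a region born at step `9`, AFTER the overdue partner's true reach [folklore] -/
def Yn : Gen PEv := Gen.born ((9, 0, 0) : PEv) 9
/-- the LATE MERGER of the two at step `9 ≤ K = 10` [folklore] -/
def Zl : Gen PEv := Gen.merge Xo Yn ((9, 2, 0) : PEv)

/-- the late merger IS consistent with horizon `D = 3` at cutoff `K = 10` (partner `Xo` overdue: `10 − 3 < 8`;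
partner `Yn` pending: `9 < 13`), [folklore] -/
theorem Zl_consistentTH : ConsistentTH id C₀ 10 (fun _ => 2) 3 Zl := by
  simp [ConsistentTH, Zl, Xo, Yn, C₀, Gen.reach, Gen.rootStep, dictW, PEv.kind, PEv.step, PEv.fat, fatWait]

/-- … it is NOT `ConsistentT` (the merger step `9` is not `< reach Xo = 8`), [folklore] -/
theorem Zl_not_consistentT : ¬ ConsistentT id C₀ 10 (fun _ => 2) Zl := by
  simp [ConsistentT, Zl, Xo, Yn, C₀, Gen.reach, Gen.rootStep, dictW, PEv.kind, PEv.step, PEv.fat, fatWait]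

/-- … it is NOT well formed for the true table (`rootStep Yn = 9` is not `< reach Xo = 8`), [folklore] -/
theorem Zl_not_wf : ¬ Zl.WF (dictWT id (fun _ => 2) C₀.n₁) := by
  simp [Gen.WF, Zl, Xo, Yn, C₀, Gen.reach, Gen.rootStep, dictW, PEv.kind, PEv.fat, fatWait]

/-- … it IS fresh and hence well formed for the PADDED table (`reach♯ Xo = 11 > 9`), [folklore] -/
theorem Zl_wf_padW : FreshT Zl ∧ Zl.WF (padW (dictWT id (fun _ => 2) C₀.n₁) 3) := by
  constructor
  · simp [FreshT, Zl, Xo, Yn]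
  · simp [Gen.WF, Zl, Xo, Yn, C₀, Gen.reach, Gen.rootStep, dictW, PEv.kind, PEv.fat, fatWait]

/-- … and it is pending at the horizon (`10 − 3 < reach Zl = 13 + 3`), so it is an admissible witness of the new
labelling binder that the old binder could not name. [folklore] -/
theorem Zl_pending : 10 - 3 < Zl.reach (dictWT id (fun _ => 2) C₀.n₁) := by
  simp [Zl, Xo, Yn, C₀, Gen.reach, dictW, PEv.kind, PEv.fat, fatWait]

/-- its horizon span plus partner ages (`(8 − 4) + (9 + 1 − 9) = 5`) is within its merger-padded banks
(`4 + 4 + (1 + 2 + 3) = 14`) — `ConsistentTH.spanAges` decided on the instance [folklore] -/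
theorem Zl_span : (10 - 3 + 1 - Zl.rootStep) + partnerAges (PEv.step ∘ id) Zl = 5 ∧
    ∑ e ∈ Zl.events, bankW id (fun _ => 2) C₀.n₁ 3 e = 14 := by
  constructor
  · simp [Zl, Xo, Yn, Gen.rootStep, partnerAges, PEv.step]
  · rw [show Zl.events = {((9, 2, 0) : PEv), ((4, 0, 0) : PEv), ((9, 0, 0) : PEv)} by decide]
    simp [bankW, C₀, dictW, PEv.kind, PEv.fat, fatWait]

end Sanity

/-- at `D = 0` the new labelling data are the old ones: `ConsistentTH … 0 = ConsistentT …`, `padW W 0 = W`,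
`bankW … 0 = dictWT …` (so `exists_irThreshold_relWeightBound_canon_lateMergers` at `D = 0`, `Δ = 1` asks exactly
what `T4CanonicalMenus.exists_irThreshold_relWeightBound_canon` asks, with `FreshT` for `WF`, which are then equivalent
by `wf_of_consistentT_freshT` / `FreshT.of_wf`). [folklore] -/
theorem lateMergers_zero {ε : Type*} [DecidableEq ε] (sh : ε → PEv) (C : T4PrintedShapeBanking.Consts) (K : ℕ)
    (R : ℕ → ℕ) (G : Gen ε) :
    (ConsistentTH sh C K R 0 G ↔ ConsistentT sh C K R G) ∧ padW (dictWT sh R C.n₁) 0 = dictWT sh R C.n₁ ∧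
      bankW sh R C.n₁ 0 = dictWT sh R C.n₁ ∧
      (ConsistentT sh C K R G → (FreshT G ↔ G.WF (dictWT sh R C.n₁))) :=
  ⟨consistentTH_zero_iff, padW_zero _, bankW_zero sh R C.n₁,
    fun hc => ⟨fun hf => wf_of_consistentT_freshT hc hf, fun hW => FreshT.of_wf _ hW⟩⟩

end Sanity

end

end Summit.QuantumFields.BalabanUV.T4Continuum.LateMergers
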